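import Summits.ResolutionOfSingularities.ResolutionOfSingularities.Theorems.FrobeniusLadderFRationalResolutionGaloisUpstairsPieceCover
import Summits.ResolutionOfSingularities.ResolutionOfSingularities.Theorems.FrobeniusLadderFRationalResolutionGaloisTwistStabilizer
import HarnessLib

/-!
# Crux `FrobeniusLadder.FRationalResolution` (stmt-ResolutionOfSingularities-15317), line `redirect`,
# stub `stub_diagonalizableQuotientResolution` — a chart point FIXED by the decomposition group yields a DECOMPOSITION-STABLE piece
# with locally regular blow-up (the inputs `(I, n, hD, hreg)` of `…GaloisBaseChangeRegular.hloc_of_decomposition_stable_piece'`)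

Composition of `…GaloisUpstairsPieceCover.exists_piece_cover` (✓p835702) and `…GaloisTwistStabilizer.map_twist_eq_self_of_map_chartTwist_eq`
(✓p836007): if every `σ` in the decomposition group of `𝔔'` has chart twist `σ''` fixing the trivial-residue point `𝔚 ⊆ (B ⊗_K K') ⊗_B C`,
the upstairs piece `I₁` is decomposition-stable ON THE NOSE, so no symmetrization and no twist-Cartier obligation is needed at this
point. (When does the hypothesis hold: whenever the residue field `κ(𝔔)` of the chart point has a unique `κ(𝔭)`-embedding into `κ(𝔔')`,
e.g. `κ(𝔔)/κ(𝔭)` purely inseparable — memo MEMO-15317-leafhand2-g14 §2; the typing of that criterion is the next [S–M] item.)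

* **`exists_decomposition_stable_piece_of_fixed_point`** — the statement above.

Honest label: plumbing toward ONE leaf stub (no stub, crux or summit closed). No definitions, no named facts, no sorry.
[cite: StacksProject, Tag 09EB; Tag 00UW; Tag 02NS]
-/

noncomputable section

-- single-problem summit: the doubled namespace component is forced
set_option linter.dupNamespace false

open CategoryTheory AlgebraicGeometry
open scoped TensorProduct
open Literature.AlgebraicGeometry.Resolution
open Summit.ResolutionOfSingularities.ResolutionOfSingularities.Theorems.FRationalResolution

namespace Summit.ResolutionOfSingularities.ResolutionOfSingularities.Theorems.FRationalResolution.GaloisFixedPointPiece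

/-- **A decomposition-stable piece from a fixed chart point.** `B` Noetherian over the field `K`, `C` a flat finitely presented formally
unramified `B`-algebra, `𝔭 ⊆ B`, `𝔔 ⊆ C` maximal with `𝔔 ∩ B = 𝔭`, `J` with `𝔔ⁿ ⊆ J ⊆ 𝔔` and `Bl_J(Spec C)` regular; `K'/K` with
`B' = B ⊗_K K'` Noetherian and `Spec B' → Spec B` smooth, `𝔔' ⊆ B'` maximal with `𝔭 B'_{𝔔'} = 𝔔' B'_{𝔔'}`; `𝔚` a trivial-residue point of
`B' ⊗_B C` over `𝔔'` and `𝔔` FIXED by the chart twists of the decomposition group. Then there is a `𝔔'`-primary piece `I ⊆ I₁`-style ideal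
with `𝔔'ⁿ ⊆ I ⊆ 𝔔'`, `(1 ⊗ σ) I ≤ I` for all `σ` in the decomposition group, and `g ∉ 𝔔'` with `Bl_{I B'_g}` regular.
[cite: StacksProject, Tag 09EB; Tag 00UW; Tag 02NS] -/
theorem exists_decomposition_stable_piece_of_fixed_point {K B K' C : Type} [Field K] [CommRing B] [Algebra K B] [Field K']
    [Algebra K K'] [CommRing C] [Algebra B C] [IsNoetherianRing B] [IsNoetherianRing (B ⊗[K] K')] [Module.Flat B C]
    [Algebra.FinitePresentation B C] [Algebra.FormallyUnramified B C]
    [Smooth (Spec.map (CommRingCat.ofHom (algebraMap B (B ⊗[K] K'))))]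
    (𝔭 : Ideal B) [𝔭.IsMaximal] (𝔔 : Ideal C) [𝔔.IsMaximal] (h𝔔𝔭 : 𝔔.comap (algebraMap B C) = 𝔭)
    (J : Ideal C) {n : ℕ} (hJ : 𝔔 ^ n ≤ J) (hJ𝔔 : J ≤ 𝔔) (hregJ : Scheme.IsRegular (affineBlowup J))
    (𝔔' : Ideal (B ⊗[K] K')) [𝔔'.IsMaximal]
    (hred : 𝔭.map (algebraMap B (Localization.AtPrime 𝔔')) = IsLocalRing.maximalIdeal (Localization.AtPrime 𝔔'))
    (𝔚 : Ideal ((B ⊗[K] K') ⊗[B] C)) [𝔚.IsMaximal]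
    (h𝔚B : 𝔚.comap (algebraMap (B ⊗[K] K') ((B ⊗[K] K') ⊗[B] C)) = 𝔔')
    (h𝔚C : 𝔚.comap ((Algebra.TensorProduct.includeRight : C →ₐ[B] (B ⊗[K] K') ⊗[B] C) : C →+* (B ⊗[K] K') ⊗[B] C) = 𝔔)
    (hres : ∀ x : (B ⊗[K] K') ⊗[B] C, ∃ b' : B ⊗[K] K', x - algebraMap (B ⊗[K] K') ((B ⊗[K] K') ⊗[B] C) b' ∈ 𝔚)
    (hfix : ∀ σ : K' ≃ₐ[K] K',
      𝔔'.map (Algebra.TensorProduct.map (AlgHom.id B B) (σ : K' →ₐ[K] K')) = 𝔔' →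
      𝔚.map (Algebra.TensorProduct.map (Algebra.TensorProduct.map (AlgHom.id B B) (σ : K' →ₐ[K] K'))
        (AlgHom.id B C)) = 𝔚) :
    ∃ I : Ideal (B ⊗[K] K'), 𝔔' ^ n ≤ I ∧ I ≤ 𝔔' ∧
      (∀ σ : K' ≃ₐ[K] K',
        𝔔'.map (Algebra.TensorProduct.map (AlgHom.id B B) (σ : K' →ₐ[K] K')) = 𝔔' →
        I.map (Algebra.TensorProduct.map (AlgHom.id B B) (σ : K' →ₐ[K] K')) ≤ I) ∧
      ∃ g : B ⊗[K] K', g ∉ 𝔔' ∧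
        Scheme.IsRegular (affineBlowup (I.map (algebraMap (B ⊗[K] K') (Localization.Away g)))) := by
  obtain ⟨I, hpI, hIp, G, hG, -, hIJ, h, hh, -, hreg⟩ :=
    GaloisUpstairsPieceCover.exists_piece_cover 𝔭 𝔔 h𝔔𝔭 J hJ hJ𝔔 hregJ 𝔔' hred 𝔚 h𝔚B h𝔚C hres
  refine ⟨I, hpI, hIp, fun σ hσ => le_of_eq ?_, h, hh, hreg⟩
  exact GaloisTwistStabilizer.map_twist_eq_self_of_map_chartTwist_eq 𝔔' I hpI J 𝔚 h𝔚B G hG hIJ σ (hfix σ hσ)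

end Summit.ResolutionOfSingularities.ResolutionOfSingularities.Theorems.FRationalResolution.GaloisFixedPointPiece

end
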